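import Literature.Geometry.Lorentzian.MinimalSurfaceBarrier
import HarnessLib

/-!
# The geometric maximum principle for minimal graphs and the barrier principle
(family `gr`, in support of **gr.S09**; namespace `Literature.Geometry.Lorentzian`)

`MinimalSurfaceBarrier.lean` reduces the boundary maximum principle
`minimalSurface_boundary_maximumPrinciple` of `ExteriorRegion.lean` (and with it the
connected-horizon Riemannian Penrose inequality) to the named fact
`minimalSurface_barrierPrinciple`, the barrier (tangency) principle for minimal surfaces in
slice-chart form. This file splits that fact into its two printed ingredients and **proves** the
split:

* `minimalGraph_strongMaximumPrinciple` — **named fact**, the geometric maximum principle of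
  Andersson–Galloway–Howard (Comm. Pure Appl. Math. 51 (1998), Thm. 3.10) in the case needed
  here: two embedded *minimal* surfaces of a Riemannian `3`-manifold which, inside a coordinate
  cylinder `V × (-r, r)` of a chart, are the graphs `x³ = u₀(x¹, x²)` and `x³ = u₁(x¹, x²)` of
  smooth functions with `u₁ ≤ u₀` on the connected base `V` and `u₁ = u₀` somewhere, have
  `u₀ ≡ u₁` (Thm. 3.10 with `H₀ = 0`, `U₀ = {x³ > u₀}`, `U₁ = {x³ < u₁}`, followed by the evident
  continuation along the connected base). Its proof in the source is the analytic strong maximum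
  principle Thm. 2.4 (vendored, in the `C²` case, as
  `Literature.Analysis.PDE.quasilinear_strongMaximumPrinciple`) applied to the mean curvature
  operator of graphs, which is quasilinear uniformly elliptic (§3.2–3.3);
* `touchingSurface_locallyGraph` — **named fact** (differential topology): a smoothly embedded
  surface lying, inside an open subset `O` of a chart domain, in the closed lower half
  `{x³ ≤ 0}` and touching the slice `{x³ = 0}` at `f w₀` is, inside a small coordinate cylinder
  around `f w₀`, exactly the graph of a smooth function `u ≤ 0` over a connected base, with
  `u = 0` under `f w₀` (first-derivative test: the surface is tangent to the slice at `f w₀`, so the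
  base projection has invertible differential there; inverse function theorem, Lee 2013,
  Thm. 4.5; and `f(W₀) = range f ∩ G` for an open `G` since `f` is an embedding);
* `minimalSurface_barrierPrinciple_of_graph` — **theorem**:
  `minimalGraph_strongMaximumPrinciple → touchingSurface_locallyGraph →
  minimalSurface_barrierPrinciple`. For `w₀ ∈ W` with `f₂ w₀ ∈ Σ₁` the cylinder of the second
  fact exhibits `Σ₁` as the graph of `0` and `f₂(S₂)` as the graph of `u ≤ 0` touching it, so
  `u ≡ 0` by the first fact and `f₂` maps a neighbourhood of `w₀` in `W` into `Σ₁`; hence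
  `{w ∈ W | f₂ w ∈ Σ₁}` is open in `W`, and it is closed in `W` (inside `O`, `Σ₁` is the zero set
  of the continuous height `x³`), so it is all of the preconnected `W`;
* `minimalSurface_boundary_maximumPrinciple_of_graph`,
  `riemannian_penrose_inequality_connected_smooth_of_graph` — the reductions of
  `MinimalSurfaceBarrier.lean` restated on the two new facts.

Dependency chain after this file:
`quasilinear_strongMaximumPrinciple` (AGH Thm. 2.4) + minimal-graph equation ⟶
`minimalGraph_strongMaximumPrinciple` (AGH Thm. 3.10); together with
`touchingSurface_locallyGraph` ⟶ `minimalSurface_barrierPrinciple` ⟶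
`minimalSurface_boundary_maximumPrinciple` ⟶ (with Huisken–Ilmanen's Lemma 4.1 and Main
Theorem) `riemannian_penrose_inequality_connected_smooth`.

## Mathlib

As in `MinimalSurfaceBarrier.lean`; additionally `IsPreconnected.subset_left_of_subset_union`,
`ContinuousOn.isOpen_inter_preimage`, `IsOpen.prod`. Mathlib has the inverse function theorem
on normed spaces (`ContDiffAt.toPartialHomeomorph`) and slice charts of immersions, from which
`touchingSurface_locallyGraph` is provable; it is vendored as a named fact pending that proof.

## Design choices

* *Cylinders, not boxes.* Thm. 3.10 is printed for a coordinate box `{|xⁱ| < r}` centred at the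
  touching point; we use a cylinder `V × (-r, r)` over an arbitrary open preconnected base `V`
  (pulled back to `X` as `{x ∈ ψ.source | T (ψ x) ∈ V ×ˢ Ioo (-r) r}`, with
  `T⁻¹(V × (-r, r)) ⊆ ψ.target`), and conclude `u₀ = u₁` on all of `V`: the printed local
  statement at each coincidence point plus the clopen argument on `V`. Graphs are described as
  *sets* (`range fᵢ ∩ C = {x ∈ C | x³ = uᵢ(x¹, x²)}`), as `Σ₁ ∩ O` is in
  `minimalSurface_barrierPrinciple`, so that no reparametrisation of the immersions is needed.
* *Smooth graph functions.* Thm. 3.10 assumes `u₀, u₁` merely Lipschitz (smoothness is then a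
  conclusion); we assume them `C^∞` on `V` — a stronger hypothesis, which is what
  `touchingSurface_locallyGraph` delivers.
* *Faithfulness.* `minimalGraph_strongMaximumPrinciple` carries the hypotheses of Thm. 3.10
  (with `H₀ = 0` both contact-mean-curvature conditions hold for smooth minimal boundaries, the
  one-sided Hessian bound being automatic for a smooth compact piece of surface, Def. 3.9) or
  stronger ones, and asserts part of its conclusion (`u₀ ≡ u₁`; not the regularity clause).

## References

* L. Andersson, G. J. Galloway, R. Howard, *A strong maximum principle for weak solutions of
  quasi-linear elliptic equations with applications to Lorentzian and Riemannian geometry*,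
  Comm. Pure Appl. Math. 51 (1998) 581–624 (arXiv:dg-ga/9707015): Def. 3.9, Thm. 3.10, and
  §3.2 (the mean curvature operator is uniformly elliptic on Lipschitz graphs).
* J.-H. Eschenburg, *Maximum principle for hypersurfaces*, Manuscripta Math. 64 (1989) 55–75,
  Thm. 1 (the `C²` case).
* J. M. Lee, *Introduction to Smooth Manifolds*, 2nd ed., Springer 2013, Thm. 4.5 (inverse
  function theorem for manifolds), Thm. 5.8 and Prop. 5.2.
-/

noncomputable section

open Bundle Set Manifold TopologicalSpace Filter Function
open scoped ContDiff Topology Manifold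

namespace Literature.Geometry.Lorentzian

open PseudoRiemannianMetric

/-! ### The geometric maximum principle for minimal graphs (AGH Thm. 3.10, `H₀ = 0`) -/

/-- **Geometric maximum principle for minimal graphs** (named fact). Andersson–Galloway–Howard
1998, Thm. 3.10: *let `(M, g)` be a Riemannian manifold, `U₀, U₁ ⊆ M` disjoint open sets and
`H₀` a constant such that `∂U₀` has mean curvature `≥ -H₀` in the sense of contact hypersurfaces
and `∂U₁` has mean curvature `≥ H₀` in the sense of contact hypersurfaces with a one-sided
Hessian bound (Def. 3.9); let `p ∈ Ū₀ ∩ Ū₁` have a neighbourhood `𝒩` with coordinates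
`x¹, …, xⁿ` centred at `p`, with image the box `{|xⁱ| < r}`, and Lipschitz functions `u₀, u₁`
on `{|xⁱ| < r, i < n}` with values in `(-r, r)` such that `U₀ ∩ 𝒩 = {xⁿ > u₀(x¹, …, xⁿ⁻¹)}` and
`U₁ ∩ 𝒩 = {xⁿ < u₁(x¹, …, xⁿ⁻¹)}` (so `u₁ ≤ u₀` and `u₁(0) = u₀(0)`). Then `u₀ ≡ u₁`, `u₀` is
smooth, and `∂U₀ ∩ 𝒩 = ∂U₁ ∩ 𝒩` is a smooth embedded hypersurface of constant mean curvature
`H₀`.* Vendored in the case `H₀ = 0` with both boundaries smooth and *minimal*, for surfaces in a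
Riemannian `3`-manifold `(X, h)`, in the slice-chart language of
`minimalSurface_barrierPrinciple`: `Σᵢ = range fᵢ` (`i = 0, 1`) are smoothly embedded minimal
surfaces (`H = 0` for smooth unit normals `νᵢ`, `IsMaximalSlice`; then either orientation has
mean curvature `0 ≥ 0`, and the second fundamental form of a smooth surface is bounded on
compact pieces, so both conditions of Def. 3.9 hold for `U₀ = {x³ > u₀}`, `U₁ = {x³ < u₁}`);
`ψ` is a chart of the maximal `C^∞` atlas, `T : E3 ≃ ℝ² × ℝ` linear, `V ⊆ ℝ²` open and
preconnected, `r > 0`, the cylinder `T⁻¹(V × (-r, r))` lies in `ψ.target` and, writing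
`C = {x ∈ ψ.source | T (ψ x) ∈ V × (-r, r)}` and `(x', x³) = T (ψ x)`, inside `C` the surface
`Σᵢ` is exactly the graph `{x ∈ C | x³ = uᵢ(x')}` of a function `uᵢ` smooth on `V` with values
in `(-r, r)` (smoothness is a hypothesis here, Lipschitz in the source). If `u₁ ≤ u₀` on `V`
and `u₁(y) = u₀(y)` for some `y ∈ V`, then `u₀ = u₁` on `V` (the printed conclusion near each
coincidence point, continued along the connected `V` by the clopen argument). The standing
hypotheses `hpbᵢ`, `[HasLeviCivita]` are those of `Hypersurface.lean`. Printed proof: Thm. 2.4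
(`Literature.Analysis.PDE.quasilinear_strongMaximumPrinciple`) for the mean curvature operator
of graphs, uniformly elliptic on Lipschitz graphs (§3.2).
[cite: AnderssonGallowayHoward1998, Thm. 3.10 (case H₀ = 0) and Def. 3.9]
[cite: Eschenburg1989, Thm. 1] -/
def minimalGraph_strongMaximumPrinciple : Prop :=
  ∀ (X : Type) [TopologicalSpace X] [ChartedSpace E3 X] [IsManifold (𝓡 3) ∞ X] [T2Space X]
    [SecondCountableTopology X]
    (h : ContMDiffRiemannianMetric (𝓡 3) ∞ E3 (TangentSpace (𝓡 3) : X → Type _))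
    [(ofRiemannian h).HasLeviCivita]
    (S₀ : Type) [TopologicalSpace S₀] [ChartedSpace (EuclideanSpace ℝ (Fin 2)) S₀]
    [IsManifold (𝓡 2) ∞ S₀] [T2Space S₀]
    (f₀ : S₀ → X) (ν₀ : NormalField (𝓡 3) f₀) (hpb₀ : contMDiff_pullbackBilin (𝓡 3) X (𝓡 2) S₀ ∞)
    (hf₀ : (ofRiemannian h).IsSpacelikeImmersion (𝓡 2) f₀),
    Manifold.IsSmoothEmbedding (𝓡 2) (𝓡 3) ∞ f₀ → (ofRiemannian h).IsUnitNormal (𝓡 2) f₀ ν₀ 1 →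
    ContMDiff (𝓡 2) (𝓡 3).tangent ∞
      (fun y ↦ (TotalSpace.mk' E3 (f₀ y) (ν₀ y) : TangentBundle (𝓡 3) X)) →
    (ofRiemannian h).IsMaximalSlice f₀ hpb₀ hf₀ ν₀ →
    ∀ (S₁ : Type) [TopologicalSpace S₁] [ChartedSpace (EuclideanSpace ℝ (Fin 2)) S₁]
      [IsManifold (𝓡 2) ∞ S₁] [T2Space S₁]
      (f₁ : S₁ → X) (ν₁ : NormalField (𝓡 3) f₁)
      (hpb₁ : contMDiff_pullbackBilin (𝓡 3) X (𝓡 2) S₁ ∞)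
      (hf₁ : (ofRiemannian h).IsSpacelikeImmersion (𝓡 2) f₁),
    Manifold.IsSmoothEmbedding (𝓡 2) (𝓡 3) ∞ f₁ → (ofRiemannian h).IsUnitNormal (𝓡 2) f₁ ν₁ 1 →
    ContMDiff (𝓡 2) (𝓡 3).tangent ∞
      (fun y ↦ (TotalSpace.mk' E3 (f₁ y) (ν₁ y) : TangentBundle (𝓡 3) X)) →
    (ofRiemannian h).IsMaximalSlice f₁ hpb₁ hf₁ ν₁ →
    ∀ (ψ : OpenPartialHomeomorph X E3) (T : E3 ≃L[ℝ] EuclideanSpace ℝ (Fin 2) × ℝ)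
      (V : Set (EuclideanSpace ℝ (Fin 2))) (r : ℝ) (u₀ u₁ : EuclideanSpace ℝ (Fin 2) → ℝ),
    ψ ∈ IsManifold.maximalAtlas (𝓡 3) ∞ X → IsOpen V → IsPreconnected V → 0 < r →
    T.symm '' (V ×ˢ Ioo (-r) r) ⊆ ψ.target →
    ContDiffOn ℝ ∞ u₀ V → ContDiffOn ℝ ∞ u₁ V → MapsTo u₀ V (Ioo (-r) r) →
    MapsTo u₁ V (Ioo (-r) r) →
    range f₀ ∩ {x | x ∈ ψ.source ∧ T (ψ x) ∈ V ×ˢ Ioo (-r) r} =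
      {x | (x ∈ ψ.source ∧ T (ψ x) ∈ V ×ˢ Ioo (-r) r) ∧ (T (ψ x)).2 = u₀ (T (ψ x)).1} →
    range f₁ ∩ {x | x ∈ ψ.source ∧ T (ψ x) ∈ V ×ˢ Ioo (-r) r} =
      {x | (x ∈ ψ.source ∧ T (ψ x) ∈ V ×ˢ Ioo (-r) r) ∧ (T (ψ x)).2 = u₁ (T (ψ x)).1} →
    (∀ y ∈ V, u₁ y ≤ u₀ y) → (∃ y ∈ V, u₁ y = u₀ y) → EqOn u₀ u₁ V

/-! ### Touching embedded surfaces are locally graphs -/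

/-- **A one-sided touching surface is locally a graph** (named fact; differential topology).
Let `f : S → X` be a smooth embedding of a surface into a `3`-manifold, `ψ` a chart of the
maximal `C^∞` atlas of `X`, `T : E3 ≃ ℝ² × ℝ` linear, `O ⊆ ψ.source` open, and `W ⊆ S` open
with `f(W) ⊆ {x ∈ O | x³ ≤ 0}` (`(x', x³) = T (ψ x)`), and let `w₀ ∈ W` with `x³(f w₀) = 0`.
Then there are an open preconnected `V ⊆ ℝ²` containing `x'(f w₀)`, `r > 0` and
`u : ℝ² → ℝ` smooth on `V` with values in `(-r, r)` and `u(x'(f w₀)) = 0`, such that the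
cylinder `T⁻¹(V × (-r, r))` lies in `ψ.target`, its preimage
`C = {x ∈ ψ.source | T (ψ x) ∈ V × (-r, r)}` lies in `O`, and `range f ∩ C` is exactly the graph
`{x ∈ C | x³ = u(x')}` and is contained in `f(W)`. Proof (not yet formalised): the smooth
function `x³ ∘ f` on `W` has a maximum at `w₀`, so its differential vanishes there (first
derivative test) and `d(x' ∘ f)_{w₀}` is injective, hence invertible; by the inverse function
theorem (Lee 2013, Thm. 4.5) `x' ∘ f` restricts to a diffeomorphism of a neighbourhood
`W₀ ⊆ W` of `w₀` onto an open `V₀ ∋ x'(f w₀)`, and `f(W₀)` is the graph of the smooth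
`u = x³ ∘ f ∘ (x' ∘ f|_{W₀})⁻¹`; since `f` is a topological embedding, `f(W₀) = range f ∩ G` for an
open `G`, and a small cylinder inside `G ∩ O` over a ball `V ⊆ V₀` on which `|u| < r` does it.
[cite: LeeSmoothManifolds2013, Thm. 4.5 (inverse function theorem for manifolds)] -/
def touchingSurface_locallyGraph : Prop :=
  ∀ (X : Type) [TopologicalSpace X] [ChartedSpace E3 X] [IsManifold (𝓡 3) ∞ X]
    (S : Type) [TopologicalSpace S] [ChartedSpace (EuclideanSpace ℝ (Fin 2)) S]
    [IsManifold (𝓡 2) ∞ S]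
    (f : S → X) (ψ : OpenPartialHomeomorph X E3) (T : E3 ≃L[ℝ] EuclideanSpace ℝ (Fin 2) × ℝ)
    (O : Set X) (W : Set S) (w₀ : S),
    Manifold.IsSmoothEmbedding (𝓡 2) (𝓡 3) ∞ f → ψ ∈ IsManifold.maximalAtlas (𝓡 3) ∞ X →
    IsOpen O → O ⊆ ψ.source → IsOpen W → w₀ ∈ W →
    f '' W ⊆ {x | x ∈ O ∧ (T (ψ x)).2 ≤ 0} → (T (ψ (f w₀))).2 = 0 →
    ∃ (V : Set (EuclideanSpace ℝ (Fin 2))) (r : ℝ) (u : EuclideanSpace ℝ (Fin 2) → ℝ),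
      IsOpen V ∧ IsPreconnected V ∧ (T (ψ (f w₀))).1 ∈ V ∧ 0 < r ∧
      T.symm '' (V ×ˢ Ioo (-r) r) ⊆ ψ.target ∧
      {x | x ∈ ψ.source ∧ T (ψ x) ∈ V ×ˢ Ioo (-r) r} ⊆ O ∧
      ContDiffOn ℝ ∞ u V ∧ MapsTo u V (Ioo (-r) r) ∧ u (T (ψ (f w₀))).1 = 0 ∧
      range f ∩ {x | x ∈ ψ.source ∧ T (ψ x) ∈ V ×ˢ Ioo (-r) r} =
        {x | (x ∈ ψ.source ∧ T (ψ x) ∈ V ×ˢ Ioo (-r) r) ∧ (T (ψ x)).2 = u (T (ψ x)).1} ∧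
      range f ∩ {x | x ∈ ψ.source ∧ T (ψ x) ∈ V ×ˢ Ioo (-r) r} ⊆ f '' W

/-! ### The barrier principle from the two facts -/

/-- **The barrier principle for minimal surfaces, from the maximum principle for minimal graphs
and the local graph representation.**
`minimalGraph_strongMaximumPrinciple → touchingSurface_locallyGraph →
minimalSurface_barrierPrinciple`. Let `Σ₁ ∩ O` be the slice `{x³ = 0}` of `O` and `f₂(W)` lie in
`{x ∈ O | x³ ≤ 0}`, `W` open preconnected, touching `Σ₁`. The set `A = {w ∈ W | f₂ w ∈ Σ₁}` is
nonempty; it is open: at `w₀ ∈ A` the cylinder `C` of `touchingSurface_locallyGraph` exhibits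
`Σ₁ ∩ C` as the graph of `0` (as `C ⊆ O`) and `range f₂ ∩ C ⊆ f₂(W)` as the graph of a smooth
`u ≤ 0` with `u = 0` under `f₂ w₀`, so `u ≡ 0` on the base by
`minimalGraph_strongMaximumPrinciple`, i.e. `range f₂ ∩ C ⊆ Σ₁`, and `W ∩ f₂⁻¹(C) ⊆ A` is a
neighbourhood of `w₀`; and `W ∖ A = W ∩ f₂⁻¹{x ∈ ψ.source | x³ ≠ 0}` is open. Hence `A = W`.
This is the way Thm. 3.10 is applied to smooth hypersurfaces (AGH 1998, §3.3; Eschenburg 1989).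
[cite: AnderssonGallowayHoward1998, Thm. 3.10] -/
theorem minimalSurface_barrierPrinciple_of_graph (hmax : minimalGraph_strongMaximumPrinciple)
    (hgraph : touchingSurface_locallyGraph) : minimalSurface_barrierPrinciple := by
  intro X _ _ _ _ _ h _ S₁ _ _ _ _ f₁ ν₁ hpb₁ hf₁ hemb₁ hunit₁ hν₁ hmin₁ S₂ _ _ _ _ f₂ ν₂ hpb₂ hf₂
    hemb₂ hunit₂ hν₂ hmin₂ ψ T O W hψ hO hOψ hplane hWopen hWconn hWle hmeet
  -- the height coordinate `x³ = (T (ψ x)).2` is continuous on `ψ.source`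
  have hcont : ContinuousOn (fun x ↦ (T (ψ x)).2) ψ.source :=
    continuous_snd.comp_continuousOn (T.continuous.comp_continuousOn ψ.continuousOn)
  have hf₂c : Continuous f₂ := hemb₂.isEmbedding.continuous
  have hWO : ∀ w ∈ W, f₂ w ∈ O := fun w hw ↦ (hWle (mem_image_of_mem f₂ hw)).1
  -- membership in `Σ₁` of points of `O` is the vanishing of the height
  have hmem : ∀ x ∈ O, (x ∈ range f₁ ↔ (T (ψ x)).2 = 0) := by
    intro x hxO
    constructor
    · intro hx
      have : x ∈ range f₁ ∩ O := ⟨hx, hxO⟩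
      rw [hplane] at this
      exact this.2
    · intro hx0
      have : x ∈ {x | x ∈ O ∧ (T (ψ x)).2 = 0} := ⟨hxO, hx0⟩
      rw [← hplane] at this
      exact this.1
  -- the two relatively open pieces of `W`
  set A : Set S₂ := {w | w ∈ W ∧ f₂ w ∈ range f₁} with hA
  set B : Set S₂ := W ∩ f₂ ⁻¹' (ψ.source ∩ (fun x ↦ (T (ψ x)).2) ⁻¹' {t | t ≠ 0}) with hB
  have hBopen : IsOpen B :=
    hWopen.inter ((hcont.isOpen_inter_preimage ψ.open_source isOpen_ne).preimage hf₂c)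
  -- `A` is open: the heart of the matter
  have hAopen : IsOpen A := by
    rw [isOpen_iff_mem_nhds]
    rintro w₀ ⟨hw₀W, hw₀S⟩
    have h0 : (T (ψ (f₂ w₀))).2 = 0 := (hmem _ (hWO w₀ hw₀W)).1 hw₀S
    obtain ⟨V, r, u, hVopen, hVconn, hy₀V, hr, hcyl, hCO, hu, huV, huy₀, hgraph₂, hsubW⟩ :=
      hgraph X S₂ f₂ ψ T O W w₀ hemb₂ hψ hO hOψ hWopen hw₀W hWle h0
    set C : Set X := {x | x ∈ ψ.source ∧ T (ψ x) ∈ V ×ˢ Ioo (-r) r} with hC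
    -- inside `C`, `Σ₁` is the graph of `0`
    have hgraph₁ : range f₁ ∩ C = {x | (x ∈ ψ.source ∧ T (ψ x) ∈ V ×ˢ Ioo (-r) r) ∧
        (T (ψ x)).2 = (fun _ ↦ (0 : ℝ)) (T (ψ x)).1} := by
      ext x
      simp only [mem_inter_iff, mem_setOf_eq, hC]
      constructor
      · rintro ⟨hxS, hxC⟩
        exact ⟨hxC, (hmem x (hCO hxC)).1 hxS⟩
      · rintro ⟨hxC, hx0⟩
        exact ⟨(hmem x (hCO hxC)).2 hx0, hxC⟩
    -- `u ≤ 0` on `V`: the graph point over `y` lies in `f₂(W) ⊆ {x³ ≤ 0}`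
    have hule : ∀ y ∈ V, u y ≤ (fun _ ↦ (0 : ℝ)) y := by
      intro y hy
      have hq : T.symm (y, u y) ∈ ψ.target := hcyl (mem_image_of_mem _ ⟨hy, huV hy⟩)
      set x : X := ψ.symm (T.symm (y, u y)) with hx
      have hxs : x ∈ ψ.source := ψ.map_target hq
      have hTx : T (ψ x) = (y, u y) := by
        rw [hx, ψ.right_inv hq, ContinuousLinearEquiv.apply_symm_apply]
      have hxC : x ∈ C := ⟨hxs, by rw [hTx]; exact ⟨hy, huV hy⟩⟩
      have hxgraph : x ∈ range f₂ ∩ C := by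
        rw [hgraph₂]
        exact ⟨hxC, by rw [hTx]⟩
      have := (hWle (hsubW hxgraph)).2
      rw [hTx] at this
      exact this
    -- the maximum principle: `u ≡ 0` on `V`
    have hu0 : EqOn (fun _ ↦ (0 : ℝ)) u V :=
      hmax X h S₁ f₁ ν₁ hpb₁ hf₁ hemb₁ hunit₁ hν₁ hmin₁ S₂ f₂ ν₂ hpb₂ hf₂ hemb₂ hunit₂ hν₂ hmin₂
        ψ T V r (fun _ ↦ 0) u hψ hVopen hVconn hr hcyl contDiffOn_const hu
        (fun y _ ↦ ⟨by linarith, hr⟩) huV hgraph₁ hgraph₂ hule ⟨_, hy₀V, huy₀⟩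
    -- hence `range f₂ ∩ C ⊆ Σ₁`, and `W ∩ f₂⁻¹(C)` is a neighbourhood of `w₀` inside `A`
    have hsub : range f₂ ∩ C ⊆ range f₁ := by
      intro x hx
      have hx' := hx
      rw [hgraph₂] at hx'
      obtain ⟨hxC, hxu⟩ := hx'
      rw [← hu0 hxC.2.1] at hxu
      exact (hmem x (hCO hxC)).2 hxu
    have hCopen : IsOpen C :=
      (T.continuous.comp_continuousOn ψ.continuousOn).isOpen_inter_preimage ψ.open_source
        (hVopen.prod isOpen_Ioo)
    have hw₀C : f₂ w₀ ∈ C := by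
      refine ⟨hOψ (hWO w₀ hw₀W), ?_⟩
      change ((T (ψ (f₂ w₀))).1, (T (ψ (f₂ w₀))).2) ∈ V ×ˢ Ioo (-r) r
      rw [h0]
      exact ⟨hy₀V, by linarith, hr⟩
    refine Filter.mem_of_superset ((hWopen.inter (hCopen.preimage hf₂c)).mem_nhds ⟨hw₀W, hw₀C⟩)
      ?_
    rintro w ⟨hwW, hwC⟩
    exact ⟨hwW, hsub ⟨⟨w, rfl⟩, hwC⟩⟩
  -- `W ⊆ A ∪ B`, `A ∩ B = ∅`, `W` meets `A`: so `W ⊆ A`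
  have hcover : W ⊆ A ∪ B := by
    intro w hw
    by_cases hw0 : (T (ψ (f₂ w))).2 = 0
    · exact Or.inl ⟨hw, (hmem _ (hWO w hw)).2 hw0⟩
    · exact Or.inr ⟨hw, hOψ (hWO w hw), hw0⟩
  have hdisj : Disjoint A B := by
    rw [Set.disjoint_left]
    rintro w ⟨hwW, hwS⟩ ⟨-, -, hw0⟩
    exact hw0 ((hmem _ (hWO w hwW)).1 hwS)
  have hne : (W ∩ A).Nonempty := by
    obtain ⟨_, ⟨w, hw, rfl⟩, hwS⟩ := hmeet
    exact ⟨w, hw, hw, hwS⟩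
  have hWA : W ⊆ A := hWconn.subset_left_of_subset_union hAopen hBopen hdisj hcover hne
  rintro _ ⟨w, hw, rfl⟩
  exact (hWA hw).2

/-- **The boundary maximum principle for minimal surfaces** from the maximum principle for
minimal graphs and the local graph representation
(`minimalSurface_boundary_maximumPrinciple_of_barrierPrinciple` composed with
`minimalSurface_barrierPrinciple_of_graph`). [cite: AnderssonGallowayHoward1998, Thm. 3.10] -/
theorem minimalSurface_boundary_maximumPrinciple_of_graph
    (hmax : minimalGraph_strongMaximumPrinciple) (hgraph : touchingSurface_locallyGraph) :
    minimalSurface_boundary_maximumPrinciple :=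
  minimalSurface_boundary_maximumPrinciple_of_barrierPrinciple
    (minimalSurface_barrierPrinciple_of_graph hmax hgraph)

/-- **gr.S09, connected horizon**, with the maximum principle reduced to the two facts of this
file: `exteriorRegion_structure → riemannian_penrose_inequality_exteriorRegion →
minimalGraph_strongMaximumPrinciple → touchingSurface_locallyGraph →
riemannian_penrose_inequality_connected_smooth`.
[cite: HuiskenIlmanenIMCF2001, Main Theorem, Lemma 4.1 and §8 step 1] -/
theorem riemannian_penrose_inequality_connected_smooth_of_graph
    (h1 : exteriorRegion_structure) (h2 : riemannian_penrose_inequality_exteriorRegion)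
    (hmax : minimalGraph_strongMaximumPrinciple) (hgraph : touchingSurface_locallyGraph) :
    riemannian_penrose_inequality_connected_smooth :=
  riemannian_penrose_inequality_connected_smooth_of_barrierPrinciple h1 h2
    (minimalSurface_barrierPrinciple_of_graph hmax hgraph)

end Literature.Geometry.Lorentzian

end
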